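import Summits.Ventures.WeilGRH.TwistedSechColumns
import Summits.Ventures.WeilGRH.TwistedTailEven
import Summits.RiemannHypothesis.RiemannHypothesis.Theorems.WeilFormatCTailJPrelim
import Summits.RiemannHypothesis.RiemannHypothesis.Theorems.WeilFormatCSchurStep
import HarnessLib

/-!
# GRH arm (rh-explicit, venture WeilGRH): twisted format C with the PARITY-1 kernel — the even-sector tail majorant

Cell `rh-explicit`, WEIL TRACK — GRH ARM (lit/typing seat weil-grh-5 gen11; weil-grh-2 gen7's ASK «ONE more κ for the sech
column tail in U₂»).  The even SectorSplit column of weil-grh-1's parity-1 kernel `twistedGramCoeffOdd χ a` at a far mode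
`m ≥ B₃ ≥ 2B` is the parity-0 column plus the bonus column `Π⁺(·,m)` with `|Π⁺(i,m)| ≤ 8a/(3π²m²)`
(`TwistedSechColumns.lean`).  Peter–Paul with a free `θ' > 0`, the parity-0 majorant `even_twisted_tail_majorant_matrix`
(`TwistedTailEven.lean`, free `θ > 0`), Cauchy–Schwarz over the block and weil-10's `Σ_{m≥B₃} m⁻⁴ ≤ 1/(3(B₃−1)³)` give

* `oddParity_even_tail_majorant_matrix` — for weights `d(m) ≥ d₀ > 0` on `m ≥ B₃`:
  `Σ_{m∈Ico B₃ N} (Σ_i M⁺_odd(i,m) x_i)²/d(m) ≤ xᵀ U₂⁺ x`,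
  `U₂⁺ = (1+θ')·U₂⁺[parity 0](θ) + (1+θ'⁻¹)·(B(8a/(3π²))²/(3 d₀ (B₃−1)³))·I` — an explicit `B × B` matrix,

the `hU2e` input of `weilPositivityOnChar_of_twistedOdd_formatC_data` (`TwistedOddParityDataRung.lean`).  No definitions;
no named facts; RH/GRH-free; standard axioms.
-/

set_option autoImplicit false

noncomputable section

open Complex Finset Matrix MeasureTheory Set
open scoped Real BigOperators ComplexConjugate ArithmeticFunction.vonMangoldt

namespace Summit.Ventures.WeilGRH

open Literature.NumberTheory.LFunctions
open Literature.Analysis.SpecialFunctions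
open Summit.RiemannHypothesis.RiemannHypothesis.Theorems.WeilFormatC

variable {q : ℕ} {a : ℝ}

/-- The even SectorSplit kernel of `twistedGramCoeffOdd` = that of `twistedGramCoeff` + that of the bonus block. -/
theorem evenKernel_twistedGramCoeffOdd_eq (χ : DirichletCharacter ℂ q) (a : ℝ) (n m : ℕ) :
    (if n = 0 then twistedGramCoeffOdd χ a 0 m else if m = 0 then twistedGramCoeffOdd χ a n 0
        else (twistedGramCoeffOdd χ a n m + twistedGramCoeffOdd χ a n (-(m : ℤ))) / 2)
      = (if n = 0 then twistedGramCoeff χ a 0 m else if m = 0 then twistedGramCoeff χ a n 0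
          else (twistedGramCoeff χ a n m + twistedGramCoeff χ a n (-(m : ℤ))) / 2)
        + (if n = 0 then ((if (0 : ℤ) = (m : ℤ) then π else 0) - sechIncrCoeff a 0 m)
          else if m = 0 then ((if (n : ℤ) = 0 then π else 0) - sechIncrCoeff a n 0)
          else (((if (n : ℤ) = m then π else 0) - sechIncrCoeff a n m)
            + ((if (n : ℤ) = -(m : ℤ) then π else 0) - sechIncrCoeff a n (-(m : ℤ)))) / 2) := by
  unfold twistedGramCoeffOdd
  split_ifs <;> ring

/-- **The bonus part of the even-sector tail**: `Σ_{m∈Ico B₃ N} (Σ_i Π⁺(i,m) x_i)²/d(m) ≤ (B(8a/(3π²))²/(3d₀(B₃−1)³))·Σ x_i²`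
for `2B ≤ B₃`, `2 ≤ B₃`, `d(m) ≥ d₀ > 0`. -/
theorem sechBonus_even_tail_le (ha : 0 < a) {B B₃ : ℕ} (hBB : 2 * B ≤ B₃) (hB₃ : 2 ≤ B₃) (d : ℕ → ℝ) {d₀ : ℝ}
    (hd₀ : 0 < d₀) (hd : ∀ m, B₃ ≤ m → d₀ ≤ d m) (N : ℕ) (x : Fin B → ℝ) :
    ∑ m ∈ Finset.Ico B₃ N, (∑ i : Fin B,
        (if (i : ℕ) = 0 then ((if (0 : ℤ) = (m : ℤ) then π else 0) - sechIncrCoeff a 0 m)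
          else if m = 0 then ((if ((i : ℕ) : ℤ) = 0 then π else 0) - sechIncrCoeff a (i : ℕ) 0)
          else (((if ((i : ℕ) : ℤ) = m then π else 0) - sechIncrCoeff a (i : ℕ) m)
            + ((if ((i : ℕ) : ℤ) = -(m : ℤ) then π else 0) - sechIncrCoeff a (i : ℕ) (-(m : ℤ)))) / 2) * x i) ^ 2 / d m
      ≤ (B : ℝ) * (8 * a / (3 * π ^ 2)) ^ 2 / (3 * d₀ * (((B₃ - 1 : ℕ) : ℝ)) ^ 3) * ∑ i, x i ^ 2 := by
  -- per column: Cauchy–Schwarz with the uniform bound `8a/(3π²m²)`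
  have hcol : ∀ m ∈ Finset.Ico B₃ N, (∑ i : Fin B,
      (if (i : ℕ) = 0 then ((if (0 : ℤ) = (m : ℤ) then π else 0) - sechIncrCoeff a 0 m)
        else if m = 0 then ((if ((i : ℕ) : ℤ) = 0 then π else 0) - sechIncrCoeff a (i : ℕ) 0)
        else (((if ((i : ℕ) : ℤ) = m then π else 0) - sechIncrCoeff a (i : ℕ) m)
          + ((if ((i : ℕ) : ℤ) = -(m : ℤ) then π else 0) - sechIncrCoeff a (i : ℕ) (-(m : ℤ)))) / 2) * x i) ^ 2 / d m
      ≤ ((B : ℝ) * (8 * a / (3 * π ^ 2)) ^ 2 / d₀ * ∑ i, x i ^ 2) * (1 / ((m : ℝ) ^ 2) ^ 2) := by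
    intro m hm
    rw [Finset.mem_Ico] at hm
    have hm1 : 1 ≤ m := by omega
    have hdm : d₀ ≤ d m := hd m hm.1
    have hdpos : 0 < d m := hd₀.trans_le hdm
    have hsq := sq_sum_mul_le_card_mul (ι := Fin B) _ (fun _ ↦ 8 * a / (3 * π ^ 2 * (m : ℝ) ^ 2)) x
      (fun i ↦ abs_sechBonus_evenCol_le ha (n := (i : ℕ)) (by omega) hm1)
    simp only [Fintype.card_fin] at hsq
    rw [div_le_iff₀ hdpos]
    refine hsq.trans ?_
    rw [← Finset.mul_sum]
    have hm0 : (0 : ℝ) < m := by exact_mod_cast hm1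
    have hx : 0 ≤ ∑ i : Fin B, x i ^ 2 := Finset.sum_nonneg fun i _ ↦ sq_nonneg _
    have e : (B : ℝ) * ((8 * a / (3 * π ^ 2 * (m : ℝ) ^ 2)) ^ 2 * ∑ i : Fin B, x i ^ 2)
        = ((B : ℝ) * (8 * a / (3 * π ^ 2)) ^ 2 * ∑ i : Fin B, x i ^ 2) * (1 / ((m : ℝ) ^ 2) ^ 2) := by
      field_simp
    rw [e]
    have hK : 0 ≤ (B : ℝ) * (8 * a / (3 * π ^ 2)) ^ 2 * ∑ i : Fin B, x i ^ 2 := by positivity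
    calc ((B : ℝ) * (8 * a / (3 * π ^ 2)) ^ 2 * ∑ i : Fin B, x i ^ 2) * (1 / ((m : ℝ) ^ 2) ^ 2)
        = ((B : ℝ) * (8 * a / (3 * π ^ 2)) ^ 2 / d₀ * ∑ i : Fin B, x i ^ 2) * (1 / ((m : ℝ) ^ 2) ^ 2) * d₀ := by
          field_simp
      _ ≤ ((B : ℝ) * (8 * a / (3 * π ^ 2)) ^ 2 / d₀ * ∑ i : Fin B, x i ^ 2) * (1 / ((m : ℝ) ^ 2) ^ 2) * d m :=
          mul_le_mul_of_nonneg_left hdm (by positivity)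
  refine (Finset.sum_le_sum hcol).trans ?_
  rw [← Finset.mul_sum]
  have htail := sum_Ico_one_div_pow_two_mul_le (E := 2) (by norm_num) hB₃ N
  have hK : 0 ≤ (B : ℝ) * (8 * a / (3 * π ^ 2)) ^ 2 / d₀ * ∑ i : Fin B, x i ^ 2 := by positivity
  refine (mul_le_mul_of_nonneg_left htail hK).trans (le_of_eq ?_)
  norm_num
  ring

/-- `s·xᵀU₀x + t·(c Σ x_i²) = xᵀ(s U₀ + t c I)x`. -/
theorem quadForm_smul_add_diag {B : ℕ} (U₀ : Matrix (Fin B) (Fin B) ℝ) (s t c : ℝ) (x : Fin B → ℝ) :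
    s * (x ⬝ᵥ U₀ *ᵥ x) + t * (c * ∑ i, x i ^ 2)
      = x ⬝ᵥ (Matrix.of fun i j : Fin B ↦ s * U₀ i j + (if i = j then t * c else 0)) *ᵥ x := by
  rw [dotProduct_mulVec_eq_sum_sum, dotProduct_mulVec_eq_sum_sum]
  simp only [Matrix.of_apply, mul_add, Finset.sum_add_distrib, mul_ite, mul_zero, Finset.sum_ite_eq,
    Finset.mem_univ, if_true]
  congr 1
  · rw [Finset.mul_sum]
    refine Finset.sum_congr rfl fun i _ ↦ ?_
    rw [Finset.mul_sum]
    exact Finset.sum_congr rfl fun j _ ↦ by ring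
  · rw [← mul_assoc, Finset.mul_sum]
    exact Finset.sum_congr rfl fun i _ ↦ by ring

/-- **Even-sector tail majorant for the parity-1 kernel as `xᵀU₂⁺x`** (free Peter–Paul parameters `θ, θ' > 0`). -/
theorem oddParity_even_tail_majorant_matrix (χ : DirichletCharacter ℂ q) (ha : 0 < a) {B B₃ : ℕ} (hBB : 2 * B ≤ B₃)
    (hB₃ : 2 ≤ B₃) (d : ℕ → ℝ) {d₀ : ℝ} (hd₀ : 0 < d₀) (hd : ∀ m, B₃ ≤ m → d₀ ≤ d m) {θ θ' : ℝ} (hθ : 0 < θ)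
    (hθ' : 0 < θ') (N : ℕ) (x : Fin B → ℝ) :
    ∑ m ∈ Finset.Ico B₃ N, (∑ i : Fin B,
        (if (i : ℕ) = 0 then twistedGramCoeffOdd χ a 0 m else if m = 0 then twistedGramCoeffOdd χ a i 0
          else (twistedGramCoeffOdd χ a i m + twistedGramCoeffOdd χ a i (-(m : ℤ))) / 2) * x i) ^ 2 / d m
      ≤ x ⬝ᵥ (Matrix.of fun i j : Fin B ↦
          (1 + θ') * ((1 + θ) * ((1 + 4 / π * ∑ k ∈ weilPrimeIndex a, (Λ k : ℝ) / Real.sqrt k) / 4) ^ 2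
              / (d₀ * ((B₃ - 1 : ℕ) : ℝ)) * ((-1 : ℝ) ^ (i : ℕ) * (-1 : ℝ) ^ (j : ℕ))
            + (if i = j then (1 + θ⁻¹) * (B / (d₀ * ((B₃ : ℝ) ^ 2 * ((B₃ - 1 : ℕ) : ℝ))))
                * (2 * (i : ℕ) * (∑ k ∈ weilPrimeIndex a, (Λ k : ℝ) / Real.sqrt k) / π
                  + (((i : ℕ) : ℝ) / 2 + 8 * a * (1 + weilArchDensity (2 * a)) / (3 * π ^ 2))) ^ 2 else 0))
          + (if i = j then (1 + θ'⁻¹) * ((B : ℝ) * (8 * a / (3 * π ^ 2)) ^ 2 / (3 * d₀ * (((B₃ - 1 : ℕ) : ℝ)) ^ 3))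
              else 0)) *ᵥ x := by
  have h0 := even_twisted_tail_majorant_matrix χ ha hBB hB₃ d hd₀ hd hθ N x
  have h1 := sechBonus_even_tail_le ha hBB hB₃ d hd₀ hd N x
  -- Peter–Paul per column
  have hpp : ∀ m ∈ Finset.Ico B₃ N, (∑ i : Fin B,
      (if (i : ℕ) = 0 then twistedGramCoeffOdd χ a 0 m else if m = 0 then twistedGramCoeffOdd χ a i 0
        else (twistedGramCoeffOdd χ a i m + twistedGramCoeffOdd χ a i (-(m : ℤ))) / 2) * x i) ^ 2 / d m
      ≤ (1 + θ') * ((∑ i : Fin B,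
          (if (i : ℕ) = 0 then twistedGramCoeff χ a 0 m else if m = 0 then twistedGramCoeff χ a i 0
            else (twistedGramCoeff χ a i m + twistedGramCoeff χ a i (-(m : ℤ))) / 2) * x i) ^ 2 / d m)
        + (1 + θ'⁻¹) * ((∑ i : Fin B,
          (if (i : ℕ) = 0 then ((if (0 : ℤ) = (m : ℤ) then π else 0) - sechIncrCoeff a 0 m)
            else if m = 0 then ((if ((i : ℕ) : ℤ) = 0 then π else 0) - sechIncrCoeff a (i : ℕ) 0)
            else (((if ((i : ℕ) : ℤ) = m then π else 0) - sechIncrCoeff a (i : ℕ) m)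
              + ((if ((i : ℕ) : ℤ) = -(m : ℤ) then π else 0) - sechIncrCoeff a (i : ℕ) (-(m : ℤ)))) / 2) * x i) ^ 2
            / d m) := by
    intro m hm
    rw [Finset.mem_Ico] at hm
    have hdpos : 0 < d m := hd₀.trans_le (hd m hm.1)
    have hsplit : (∑ i : Fin B,
        (if (i : ℕ) = 0 then twistedGramCoeffOdd χ a 0 m else if m = 0 then twistedGramCoeffOdd χ a i 0
          else (twistedGramCoeffOdd χ a i m + twistedGramCoeffOdd χ a i (-(m : ℤ))) / 2) * x i)
        = (∑ i : Fin B,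
          (if (i : ℕ) = 0 then twistedGramCoeff χ a 0 m else if m = 0 then twistedGramCoeff χ a i 0
            else (twistedGramCoeff χ a i m + twistedGramCoeff χ a i (-(m : ℤ))) / 2) * x i)
          + ∑ i : Fin B,
          (if (i : ℕ) = 0 then ((if (0 : ℤ) = (m : ℤ) then π else 0) - sechIncrCoeff a 0 m)
            else if m = 0 then ((if ((i : ℕ) : ℤ) = 0 then π else 0) - sechIncrCoeff a (i : ℕ) 0)
            else (((if ((i : ℕ) : ℤ) = m then π else 0) - sechIncrCoeff a (i : ℕ) m)
              + ((if ((i : ℕ) : ℤ) = -(m : ℤ) then π else 0) - sechIncrCoeff a (i : ℕ) (-(m : ℤ)))) / 2) * x i := by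
      rw [← Finset.sum_add_distrib]
      refine Finset.sum_congr rfl fun i _ ↦ ?_
      rw [evenKernel_twistedGramCoeffOdd_eq]
      ring
    rw [hsplit, mul_div_assoc', mul_div_assoc', ← add_div]
    exact div_le_div_of_nonneg_right (sq_add_le_peterPaul hθ') hdpos.le
  refine (Finset.sum_le_sum hpp).trans ?_
  rw [Finset.sum_add_distrib, ← Finset.mul_sum, ← Finset.mul_sum]
  have hθ'1 : 0 ≤ 1 + θ' := by linarith
  have hθ'2 : 0 ≤ 1 + θ'⁻¹ := by have := inv_pos.mpr hθ'; linarith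
  refine (add_le_add (mul_le_mul_of_nonneg_left h0 hθ'1) (mul_le_mul_of_nonneg_left h1 hθ'2)).trans (le_of_eq ?_)
  -- both sides are explicit quadratic forms
  rw [quadForm_smul_add_diag]
  rfl

end Summit.Ventures.WeilGRH

end
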